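import Summits.Ventures.PercRepro.Night2LocalDQm1ZeroStruct
import Summits.Ventures.PercRepro.Night2LocalDQPenultA
import Summits.Ventures.PercRepro.Night2LocalD3ThreeTwoC
import Summits.Ventures.PercRepro.Night2LocalSimpleCount

/-!
# PercRepro — the regime `|E ∖ G| = q − 1` with AT MOST ONE coloop of `M|G`, every `q`: the structure forced by a loss
(night-2, gen 17)

`M` loopless simple, `G` a rank-`(q+1)` flat with `|E ∖ G| = q − 1`, `kColoops M G ≤ 1`.  Layer-1 requests are at most
`Φ/(q+1)` (`req_le_of_not_lay0`), the capacity of a covering set is at least `1 − Φ/q` (`k1 ≤ kColoops ≤ 1`), so a loss —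
`capS < L1` — needs at least `q − 1` layer-1 preimages next to the at most one layer-0 preimage, i.e. at least `q` coloops
of the covering set (`q_le_card_coloops_of_capS_lt_L1`); and a shadow set of a SIMPLE matroid with at least `q` coloops
is an independent `(q+1)`-set (`indep_of_le_card_coloops_of_simple`: a rank-`1` set of non-coloops is impossible — one
element would be a coloop, two would be parallel).  Hence every covering set carrying a loss is an independent
`(q+1)`-set (`indep_of_loss_ne_zero`) and every shadow set carrying layer-2 weight has exactly `q + 2` elements
(`card_eq_add_two_of_mem_ex2_le_one`) — the general-`q` form of gen 13's `card_eq_five_of_loss_ne_zero_one` /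
`card_eq_six_of_mem_ex2_one` (q = 4) and of `Night2LocalDQm1ZeroStruct` (`kColoops = 0`).  Paper: proofs/NIGHT-2-g17.md §3.
-/

open scoped Matroid

namespace PercRepro.Shadow

open Finset PerFlat ThmH

variable {α : Type*} [DecidableEq α] {M : Matroid α} [M.Finite]

section Lossy

variable {q : ℕ} {G S : Finset α}

open scoped Classical in
/-- A shadow set of a loopless SIMPLE matroid with at least `q` coloops is independent with `q + 1` elements. -/
theorem indep_of_le_card_coloops_of_simple (hs : ∀ e ∈ gr M, ∀ f ∈ gr M, e ≠ f → rkN M {e, f} = 2)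
    (hl : ∀ e ∈ gr M, M.Indep {e}) (hG : G ∈ flatsQ M (q + 1))
    (hS : S ∈ shadowAt M (q + 2) q (Uq M (q + 2) q) G) (hq : q ≤ (coloops M S).card) :
    M.Indep (S : Set α) ∧ S.card = q + 1 := by
  rcases Nat.lt_or_ge (coloops M S).card (q + 1) with hlt | hge
  · exfalso
    have hSG : S ⊆ G := subset_of_mem_shadowAt hS
    have hSg : S ⊆ gr M := hSG.trans (mem_flatsQ.1 hG).1
    have hr : rkN M S = q + 1 := rkN_eq_of_mem_shadowAt hS
    have hadd := rkN_nonColoops_add (M := M) (S := S) hSg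
    have hcq : (coloops M S).card = q := by omega
    have hr1 : rkN M (nonColoops M S) = 1 := by omega
    have hnsub : nonColoops M S ⊆ S := by unfold nonColoops; exact Finset.sdiff_subset
    rcases Nat.lt_or_ge (nonColoops M S).card 2 with h2 | h2
    · rcases Nat.lt_or_ge (nonColoops M S).card 1 with h1 | h1
      · -- no non-coloop: rank `0`
        have h0 : nonColoops M S = ∅ := Finset.card_eq_zero.1 (by omega)
        rw [h0] at hr1
        have := rkN_le_card (M := M) (∅ : Finset α)
        simp at this
        omega
      · -- exactly one non-coloop `x`: `S ∖ x = coloops S` has rank `q`, but `x` keeps the rank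
        obtain ⟨x, hx⟩ := Finset.card_eq_one.1 (by omega : (nonColoops M S).card = 1)
        have hxS : x ∈ S := hnsub (by rw [hx]; exact Finset.mem_singleton_self x)
        have hxc : x ∉ coloops M S := by
          have : x ∈ nonColoops M S := by rw [hx]; exact Finset.mem_singleton_self x
          exact (mem_nonColoops.1 this).2
        have herase : S.erase x = coloops M S := by
          ext y
          constructor
          · intro hy
            have hyS : y ∈ S := Finset.mem_of_mem_erase hy
            have hyx : y ≠ x := Finset.ne_of_mem_erase hy
            by_contra hyc
            have hyn : y ∈ nonColoops M S := mem_nonColoops.2 ⟨hyS, hyc⟩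
            rw [hx] at hyn
            exact hyx (Finset.mem_singleton.1 hyn)
          · intro hy
            have hyS : y ∈ S := coloops_subset_self S hy
            have hyx : y ≠ x := by
              rintro rfl
              exact hxc hy
            exact Finset.mem_erase.2 ⟨hyx, hyS⟩
        have h1' : rkN M (S.erase x) = rkN M S := rkN_erase_eq_of_nonColoop hxS hxc
        have h2' : rkN M (coloops M S) = (coloops M S).card := rkN_eq_card_of_indep (indep_coloops hSg)
        rw [herase] at h1'
        omega
    · -- two distinct non-coloops span rank `≤ 1`: not simple
      obtain ⟨e, he, f, hf, hef⟩ := Finset.one_lt_card.1 h2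
      have hsub : ({e, f} : Finset α) ⊆ nonColoops M S := by
        intro y hy
        rcases Finset.mem_insert.1 hy with rfl | hy'
        · exact he
        · rw [Finset.mem_singleton.1 hy']; exact hf
      have hle := rkN_mono (M := M) hsub
      have hef2 := hs e (hSg (hnsub he)) f (hSg (hnsub hf)) hef
      omega
  · exact indep_of_add_one_le_card_coloops hl hG hS hge

open scoped Classical in
/-- Layer-1 requests are at most `Φ/(2 + d)` each: `L1 S ≤ #(layer-1 preimages) · Φ/(2+d)`. -/
theorem L1_le_card_thin_mul (hG : G ∈ flatsQ M (q + 1)) {d : ℕ} (hd : (gr M \ G).card = d) (hdq : d ≤ q)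
    (S : Finset α) :
    L1 M q G S ≤ (((coverPreimages M (Uq M (q + 2) q) G S).filter (fun B => B ∉ lay0 M q G)).card : ℚ) *
      (phiQ q / (2 + (d : ℚ))) := by
  unfold L1
  have h : ∀ B ∈ (coverPreimages M (Uq M (q + 2) q) G S).filter (fun B => B ∉ lay0 M q G),
      req M q B ≤ phiQ q / (2 + (d : ℚ)) := by
    intro B hB
    rw [Finset.mem_filter] at hB
    exact req_le_of_not_lay0 hG hd hdq (mem_coverPreimages.1 hB.1).1 hB.2
  calc ∑ B ∈ (coverPreimages M (Uq M (q + 2) q) G S).filter (fun B => B ∉ lay0 M q G), req M q B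
      ≤ ∑ _B ∈ (coverPreimages M (Uq M (q + 2) q) G S).filter (fun B => B ∉ lay0 M q G),
          phiQ q / (2 + (d : ℚ)) := Finset.sum_le_sum h
    _ = _ := by rw [Finset.sum_const, nsmul_eq_mul]

open scoped Classical in
/-- The layer-1 and layer-0 preimages together are the covering preimages. -/
theorem card_thin_add_k1 (S : Finset α) :
    ((coverPreimages M (Uq M (q + 2) q) G S).filter (fun B => B ∉ lay0 M q G)).card + k1 M q G S =
      (coverPreimages M (Uq M (q + 2) q) G S).card := by
  unfold k1
  rw [add_comm]
  exact Finset.card_filter_add_card_filter_not _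

/-- The arithmetic of the loss threshold at `d = q − 1` with one layer-0 preimage:
`(q−2)·Φ/(q+1) ≤ 1 − Φ/q`. -/
theorem lossy_arith (q : ℕ) (hq : 2 ≤ q) :
    ((q : ℚ) - 2) * (phiQ q / ((q : ℚ) + 1)) ≤ 1 - phiQ q / (q : ℚ) := by
  have hq' : (2 : ℚ) ≤ (q : ℚ) := by exact_mod_cast hq
  have hq0 : (0 : ℚ) < (q : ℚ) := by linarith
  have hq1 : (0 : ℚ) < (q : ℚ) + 1 := by linarith
  have key : 1 - phiQ q / (q : ℚ) - ((q : ℚ) - 2) * (phiQ q / ((q : ℚ) + 1)) =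
      ((q : ℚ) ^ 2 + 2 * (q : ℚ) - 2) / ((q : ℚ) * ((q : ℚ) + 1) ^ 2) := by
    unfold phiQ
    field_simp
    ring
  have hnn : (0 : ℚ) ≤ ((q : ℚ) ^ 2 + 2 * (q : ℚ) - 2) / ((q : ℚ) * ((q : ℚ) + 1) ^ 2) := by
    apply div_nonneg
    · nlinarith
    · positivity
  linarith

open scoped Classical in
/-- **At `d = q − 1` with at most one coloop of `M|G`, a loss needs at least `q` coloops of the covering set.** -/
theorem q_le_card_coloops_of_capS_lt_L1 (hG : G ∈ flatsQ M (q + 1)) {d : ℕ} (hd : (gr M \ G).card = d)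
    (hdq : d + 1 = q) (hk : kColoops M G ≤ 1) (hS : S ⊆ G) (h : capS M q G S < L1 M q G S) :
    q ≤ (coloops M S).card := by
  have hdle : d ≤ q := by omega
  have hk1 : k1 M q G S ≤ 1 := (k1_le_kColoops hS).trans hk
  have hL := L1_le_card_thin_mul hG hd hdle S
  rw [phiQ_div_two_add_pred hdq] at hL
  have hcov := card_thin_add_k1 (M := M) (q := q) (G := G) S
  have hcc := card_coverPreimages_le_card_coloops (Finset.Subset.refl (Uq M (q + 2) q)) G S
  rcases Nat.lt_or_ge (k1 M q G S) 1 with hk0 | hk1'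
  · -- no layer-0 preimage: `capS = 1`
    have hk0' : k1 M q G S = 0 := by omega
    have hcap : capS M q G S = 1 := by unfold capS; rw [hk0']; simp
    rw [hcap] at h
    have := add_one_le_card_coloops_of_one_lt_L1 hG hd hdq S h
    omega
  · -- one layer-0 preimage: `capS = 1 − Φ/q`
    have hk1'' : k1 M q G S = 1 := by omega
    have hcap : capS M q G S = 1 - phiQ q / (q : ℚ) := by
      unfold capS
      rw [hk1'', hd]
      have : (1 : ℚ) + (d : ℚ) = (q : ℚ) := by exact_mod_cast (by omega : 1 + d = q)
      rw [this]; ring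
    rw [hcap] at h
    by_contra hlt
    push Not at hlt
    have ht : ((coverPreimages M (Uq M (q + 2) q) G S).filter (fun B => B ∉ lay0 M q G)).card ≤ q - 2 := by
      omega
    have hq2 : 2 ≤ q := by omega
    have ht' : (((coverPreimages M (Uq M (q + 2) q) G S).filter (fun B => B ∉ lay0 M q G)).card : ℚ) ≤
        (q : ℚ) - 2 := by
      have : (((coverPreimages M (Uq M (q + 2) q) G S).filter (fun B => B ∉ lay0 M q G)).card : ℚ) ≤
          ((q - 2 : ℕ) : ℚ) := by exact_mod_cast ht
      rw [Nat.cast_sub hq2] at this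
      simpa using this
    have hpos : (0 : ℚ) ≤ phiQ q / ((q : ℚ) + 1) := by
      have := phiQ_pos q; positivity
    have := mul_le_mul_of_nonneg_right ht' hpos
    have harith := lossy_arith q hq2
    linarith

open scoped Classical in
/-- A nonzero loss at `B ∪ {z}` means `capS < L1` there. -/
theorem capS_lt_L1_of_loss_ne_zero {B : Finset α} {z : α} (hloss : loss M q G B z ≠ 0) :
    capS M q G (insert z B) < L1 M q G (insert z B) := by
  by_contra hle
  push Not at hle
  apply hloss
  unfold loss fS
  rw [if_pos hle]
  simp

open scoped Classical in
/-- **Every covering set carrying a loss is an independent `(q+1)`-set** (`d = q − 1`, `kColoops ≤ 1`, simple loopless `M`). -/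
theorem indep_of_loss_ne_zero (hs : ∀ e ∈ gr M, ∀ f ∈ gr M, e ≠ f → rkN M {e, f} = 2)
    (hl : ∀ e ∈ gr M, M.Indep {e}) (hG : G ∈ flatsQ M (q + 1)) {d : ℕ} (hd : (gr M \ G).card = d)
    (hdq : d + 1 = q) (hk : kColoops M G ≤ 1) {B : Finset α} (hBm : B ∈ membersIn M (Uq M (q + 2) q) G)
    {z : α} (hz : z ∈ G \ clF M B) (hloss : loss M q G B z ≠ 0) :
    M.Indep ((insert z B : Finset α) : Set α) ∧ (insert z B).card = q + 1 := by
  have hS' : insert z B ∈ shadowAt M (q + 2) q (Uq M (q + 2) q) G :=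
    insert_mem_shadowAt (Finset.Subset.refl _) hG hBm hz
  have hSG : insert z B ⊆ G := subset_of_mem_shadowAt hS'
  have hq := q_le_card_coloops_of_capS_lt_L1 hG hd hdq hk hSG (capS_lt_L1_of_loss_ne_zero hloss)
  exact indep_of_le_card_coloops_of_simple hs hl hG hS' hq

open scoped Classical in
/-- **Every shadow set carrying layer-2 weight has exactly `q + 2` elements** (`d = q − 1`, `kColoops ≤ 1`). -/
theorem card_eq_add_two_of_mem_ex2_le_one (hs : ∀ e ∈ gr M, ∀ f ∈ gr M, e ≠ f → rkN M {e, f} = 2)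
    (hl : ∀ e ∈ gr M, M.Indep {e}) (hG : G ∈ flatsQ M (q + 1)) {d : ℕ} (hd : (gr M \ G).card = d)
    (hdq : d + 1 = q) (hk : kColoops M G ≤ 1) {B : Finset α} (hB : B ∈ ex2 M q G S) : S.card = q + 2 := by
  obtain ⟨z, hz, hloss⟩ := exists_loss_ne_zero_of_mem_ex2 hB
  obtain ⟨hBm, -, hBS, hsub, hcard⟩ := mem_ex2_unpack hB
  obtain ⟨-, hc⟩ := indep_of_loss_ne_zero hs hl hG hd hdq hk hBm (hsub hz) hloss
  have hzB : z ∉ B := (Finset.mem_sdiff.1 hz).2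
  rw [Finset.card_insert_of_notMem hzB] at hc
  have := Finset.card_sdiff_add_card_eq_card hBS
  omega

end Lossy

end PercRepro.Shadow
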